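import Mathlib
import HarnessLib
import Summits.HubbardSuperconductivity.HubbardSuperconductivity.Theorems.KLProgrammeC4aPPKernelMidFlatnessIdentity
import Summits.HubbardSuperconductivity.HubbardSuperconductivity.Theorems.KLProgrammeC4aPPKernelMidRows

/-!
# Route `KLProgramme` — crux C4a, S3 brick (B4) «(B4)-UMK1», «(U1)-M-LAW» kernel side: the CONSTANT-WEIGHT ANTI-DIAGONAL FLATNESS of the smooth
# comparable-levels piece is `lo/D²`-class — `|∫_{lo}^{b} ∂ᵤM(e, D−e) de| ≤ A_M·lo/D²` for every `D > 0` (`b ≥ 2D`), `A_M` n-free in the reading `lo ≍ Λ`, `βlo ≥ c`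

Cell `gate-hubbard-kl`, seat hubbard-kl-k3c3-p1 (g17; row «δμ-flow with klAngularMean constant piece»).  Part 6 of the M-rows for k3c3-p3's «(U1)-M-LAW» (pen
(R384)(A)(b)): the sizes in the identity of part 5 (`…MidFlatnessIdentity`):
`D²·∫_a^b ∂ᵤM(e,D−e) de = ∫_a^b [E_N·μ + n·m′·ρ] de − Φ(b) + Φ(a)`.  For `D ≥ D_* := 2q′(Λ+lo)` the comparable zone along the anti-diagonal has BOTH lines
beyond the shell, where `∂ₑN = (β/4)sech²(βe/2)`, `∂ᵤN = (β/4)sech²(βu/2)` exactly, so the Euler defect `E_N = e∂ₑN + u∂ᵤN` is thermally small: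
`∫|E_N μ| ≤ 4(1+2κ₀)/β`; the floor defect `|ρ| ≤ q′lo²/…` gives `∫|n m′ρ| ≤ 2κ₁q′·lo` (`a ≥ lo`); the boundary terms are `|Φ(a)| ≤ a(1+2κ₀)` (`= 0` off the zone) and
`|Φ(b)| ≤ 2(1+2κ₀)/β` for `b ≥ 2D` (Pauli blocking `0 ≤ N(b,D−b) ≤ e^{−β(b−D)}`).  Below `D_*` the envelope `hK1` gives `C₁/lo ≤ 4q′²((Λ+lo)/lo)²C₁·lo/D²`.
* §1 (tools in part 5 §5) the zone is far for `D ≥ D_*` (`midZone_far_of_antidiag`), the far forms of `∂ₑN`, `∂ᵤN` on it, the pointwise majorants `abs_eulerDefect_mu_le`,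
  `abs_n_mprime_rho_le`, the boundary terms `abs_midPhi_le`, `midPhi_eq_zero_of_ge`, `abs_midPhi_thermal_le`;
* §2 **`abs_midFlatness_line_le_of_ge_core/_of_ge/_of_ge_offZone`** (`D ≥ D_*`, `lo ≤ a ≤ b`, `2D ≤ b`: `D²|∫_a^b| ≤ 6(1+2κ₀)/β + 2κ₁q′lo + |Φ(a)|`,
  `|Φ(a)| ≤ a(1+2κ₀)`, `Φ(a) = 0` when `2q′a ≤ |D−a|`),
  **`abs_midFlatness_line_le`** (ALL `D > 0`, `a = lo`, `b ≥ max(lo, 2D)`: `≤ A_M·lo/D²`, `A_M = 4q′²((Λ+lo)/lo)²C₁ + (1+2κ₀)(1 + 6/(β·lo)) + 2κ₁q′`).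
Pure real analysis; nothing asserts (C), K3, the window or superconductivity.
References: BGM 2006 §2.1 (2.2)–(2.5), §2.4 (2.36) [cite: BenfattoGiulianiMastropietro2006]; FST II CPAM 51 (1998) §3 [cite: FeldmanSalmhoferTrubowitz1998].
-/

noncomputable section

namespace Summit.HubbardSuperconductivity.HubbardSuperconductivity.Theorems.C4a

set_option linter.dupNamespace false -- summit = problem name (single-conjunct summit), D-0017

open Real Filter Set MeasureTheory intervalIntegral
open scoped Topology Interval
open Literature.MathematicalPhysics.QuantumLattice Literature.Analysis.SpecialFunctions

/-! ## §1 The zone is far; pointwise majorants; boundary terms -/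

section Sizes

variable {β Λ : ℝ} (hβ : 0 < β) (hΛ : 0 < Λ) {B₁ : ℝ} (hB₁ : ∀ x, |deriv salmhoferCutoff x| ≤ B₁)
  {κ κ' : ℝ → ℝ} {κ₀ κ₁ : ℝ} (hκb : ∀ t ∈ Icc 0 1, |κ t| ≤ κ₀) (hκ'b : ∀ t ∈ Icc 0 1, |κ' t| ≤ κ₁)
  {t₁ : ℝ} (ht₀ : 0 < t₁) (ht25 : t₁ ≤ 2 / 5)
  (hκs : ∀ t, t₁ ≤ t → κ t = 0) (hκ's : ∀ t, t₁ ≤ t → κ' t = 0) (hκ1 : ∀ t, t ≤ t₁ / 2 → κ t = 1) (hκ'1 : ∀ t, t ≤ t₁ / 2 → κ' t = 0)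
  {lo : ℝ} (hlo : 0 < lo) (hloΛ : lo ≤ Λ)

set_option maxHeartbeats 400000 in
include ht₀ ht25 hlo hloΛ in
/-- **On the zone along the anti-diagonal both lines are beyond the shell** once `D ≥ 2q′(Λ+lo)`: `0 < e`, zone at `(e, D−e)` ⟹ `Λ < e ∧ Λ < |D−e|`. [folklore] -/
theorem midZone_far_of_antidiag {D e : ℝ} (hD : 2 * ((2 - t₁) / t₁) * (Λ + lo) ≤ D) (he : 0 < e)
    (hz : ppSmoothScale lo (D - e) < (2 - t₁) / t₁ * ppSmoothScale lo e ∧ ppSmoothScale lo e < (2 - t₁) / t₁ * ppSmoothScale lo (D - e)) :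
    Λ < e ∧ Λ < |D - e| := by
  set q : ℝ := (2 - t₁) / t₁ with hq
  have hq4 : 4 ≤ q := midRatio_ge_four ht₀ ht25
  have hSe := ppSmoothScale_le_add hlo.le e
  have hSu := ppSmoothScale_le_add hlo.le (D - e)
  have hae : |e| = e := abs_of_pos he
  rw [hae] at hSe
  -- `m̃ₑ + m̃ᵤ ≥ e + |D−e| ≥ D`
  have hsum : D ≤ ppSmoothScale lo e + ppSmoothScale lo (D - e) := by
    have h1 := abs_le_ppSmoothScale lo e; have h2 := abs_le_ppSmoothScale lo (D - e)
    rw [hae] at h1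
    have : D ≤ e + |D - e| := by have := le_abs_self (D - e); linarith
    linarith
  constructor
  · -- `q m̃ₑ > m̃ᵤ` and `m̃ₑ + m̃ᵤ ≥ D` ⟹ `(1+q) m̃ₑ > D` ⟹ `e ≥ m̃ₑ − lo > D/(1+q) − lo ≥ Λ`
    nlinarith [hz.1]
  · nlinarith [hz.2]

include hβ hΛ hB₁ in
/-- The far forms on the anti-diagonal: `Λ < e`, `Λ < |D−e|` ⟹ `∂ₑN(e,D−e) = (β/4)sech²(βe/2)` and `∂ᵤN(e,D−e) = (β/4)sech²(β(D−e)/2)`.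
[cite: BenfattoGiulianiMastropietro2006, §2.1 (2.2)-(2.5)] -/
theorem ppTrueNumeratorDu_antidiag_far {D e : ℝ} (he : Λ < e) (hu : Λ < |D - e|) :
    ppTrueNumeratorDu β Λ (D - e) e = β / 4 * sech (β * e / 2) ^ 2 ∧ ppTrueNumeratorDu β Λ e (D - e) = β / 4 * sech (β * (D - e) / 2) ^ 2 := by
  have hB := hB₁
  refine ⟨ppTrueNumeratorDu_far_of_abs_far hβ hΛ he hu, ?_⟩
  rcases lt_or_ge 0 (D - e) with hpos | hnp
  · rw [abs_of_pos hpos] at hu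
    exact ppTrueNumeratorDu_far_of_abs_far hβ hΛ hu (by rw [abs_of_pos (hΛ.trans he)]; exact he)
  · rw [abs_of_nonpos hnp] at hu
    have h := ppTrueNumeratorDu_far_of_abs_far (β := β) hβ hΛ hu (e := -e) (by rw [abs_neg, abs_of_pos (hΛ.trans he)]; exact he)
    rw [ppTrueNumeratorDu_neg_neg] at h
    rw [h, show β * -(D - e) / 2 = -(β * (D - e) / 2) by ring, sech_neg]

set_option maxHeartbeats 400000 in
include hβ hΛ hB₁ hκb ht₀ ht25 hκs hκ's hκ1 hκ'1 hlo hloΛ in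
/-- **Pointwise majorant of the Euler-defect term**: `D ≥ 2q′(Λ+lo)`, `0 < e` ⟹
`|E_N(e)·μ(e)| ≤ (1+2κ₀)·(βe·e^{−βe} + β|D−e|·e^{−β|D−e|})` (off the zone `μ = 0`). [cite: BenfattoGiulianiMastropietro2006, §2.1 (2.2)-(2.5)] -/
theorem abs_eulerDefect_mu_le {D e : ℝ} (hD : 2 * ((2 - t₁) / t₁) * (Λ + lo) ≤ D) (he : 0 < e) :
    |(e * ppTrueNumeratorDu β Λ (D - e) e + (D - e) * ppTrueNumeratorDu β Λ e (D - e)) * (1 - κ (ppSmoothRatio lo e (D - e)) - κ (1 - ppSmoothRatio lo e (D - e)))| ≤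
      (1 + 2 * κ₀) * (β * e * Real.exp (-(β * e)) + β * |D - e| * Real.exp (-(β * |D - e|))) := by
  have hκ₀ : 0 ≤ κ₀ := (abs_nonneg _).trans (hκb 0 (left_mem_Icc.2 zero_le_one))
  by_cases hz : ppSmoothScale lo (D - e) < (2 - t₁) / t₁ * ppSmoothScale lo e ∧ ppSmoothScale lo e < (2 - t₁) / t₁ * ppSmoothScale lo (D - e)
  · obtain ⟨hef, huf⟩ := midZone_far_of_antidiag ht₀ ht25 hlo hloΛ hD he hz
    obtain ⟨h1, h2⟩ := ppTrueNumeratorDu_antidiag_far hβ hΛ hB₁ hef huf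
    have hr := ppSmoothRatio_mem_Ioo hlo e (D - e)
    have hμ : |1 - κ (ppSmoothRatio lo e (D - e)) - κ (1 - ppSmoothRatio lo e (D - e))| ≤ 1 + 2 * κ₀ := by
      have hk1 := hκb _ ⟨hr.1.le, hr.2.le⟩
      have hk2 := hκb (1 - ppSmoothRatio lo e (D - e)) ⟨by linarith [hr.2], by linarith [hr.1]⟩
      have h3 := abs_sub (1 : ℝ) (κ (ppSmoothRatio lo e (D - e))); rw [abs_one] at h3
      calc _ ≤ |1 - κ (ppSmoothRatio lo e (D - e))| + |κ (1 - ppSmoothRatio lo e (D - e))| := abs_sub _ _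
        _ ≤ 1 + 2 * κ₀ := by linarith
    -- `|x·(β/4)sech²(βx/2)| ≤ β|x|e^{−β|x|}`
    have hsech : ∀ x : ℝ, |x * (β / 4 * sech (β * x / 2) ^ 2)| ≤ β * |x| * Real.exp (-(β * |x|)) := fun x => by
      have hs : sech (β * x / 2) ^ 2 = sech (β * |x| / 2) ^ 2 := by
        rcases le_or_gt 0 x with h | h
        · rw [abs_of_nonneg h]
        · rw [abs_of_neg h, show β * -x / 2 = -(β * x / 2) by ring, sech_neg]
      have hb := sech_half_sq_le_four_exp_neg (show 0 ≤ β * |x| by positivity)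
      rw [show β * |x| / 2 = β * |x| / 2 by rfl] at hb
      rw [abs_mul, hs, abs_of_nonneg (by positivity : (0 : ℝ) ≤ β / 4 * sech (β * |x| / 2) ^ 2)]
      calc |x| * (β / 4 * sech (β * |x| / 2) ^ 2) ≤ |x| * (β / 4 * (4 * Real.exp (-(β * |x|)))) := by gcongr
        _ = β * |x| * Real.exp (-(β * |x|)) := by ring
    rw [abs_mul, h1, h2, mul_comm]
    refine mul_le_mul hμ ((abs_add_le _ _).trans (add_le_add ?_ (hsech (D - e)))) (abs_nonneg _) (by positivity)
    have := hsech e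
    rwa [abs_of_pos he] at this
  · obtain ⟨h0, -, -⟩ := midFactor_eq_zero_of_not_comparable ht₀ ht25 hκs hκ's hκ1 hκ'1 hlo hz
    rw [h0, mul_zero, abs_zero]; positivity

set_option maxHeartbeats 400000 in
include hβ hκ'b ht₀ ht25 hκs hκ's hκ1 hκ'1 hlo in
/-- **Pointwise majorant of the floor-defect term**: `0 < e` ⟹ `|n·(κ′(1−r)−κ′(r))·ρ| ≤ 2κ₁q′·lo²/e²` (`|N| ≤ 1`; off the zone `κ′` terms vanish; on it
`m̃ₑm̃ᵤ ≥ m̃ₑ²/q′ ≥ e²/q′` and `|e²−u²| ≤ (m̃ₑ+m̃ᵤ)²`). [folklore] -/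
theorem abs_n_mprime_rho_le (D : ℝ) {e : ℝ} (he : 0 < e) :
    |ppTrueNumerator β Λ e (D - e) * (κ' (1 - ppSmoothRatio lo e (D - e)) - κ' (ppSmoothRatio lo e (D - e))) *
        (lo ^ 2 * (e ^ 2 - (D - e) ^ 2) / (ppSmoothScale lo e * ppSmoothScale lo (D - e) * (ppSmoothScale lo e + ppSmoothScale lo (D - e)) ^ 2))| ≤
      2 * κ₁ * ((2 - t₁) / t₁) * (lo ^ 2 / e ^ 2) := by
  have hκ₁ : 0 ≤ κ₁ := (abs_nonneg _).trans (hκ'b 0 (left_mem_Icc.2 zero_le_one))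
  set q : ℝ := (2 - t₁) / t₁ with hq
  have hq4 : 4 ≤ q := midRatio_ge_four ht₀ ht25
  have h1 := ppSmoothScale_pos hlo e
  have h2 := ppSmoothScale_pos hlo (D - e)
  by_cases hz : ppSmoothScale lo (D - e) < (2 - t₁) / t₁ * ppSmoothScale lo e ∧ ppSmoothScale lo e < (2 - t₁) / t₁ * ppSmoothScale lo (D - e)
  · have hN := abs_ppTrueNumerator_le_one hβ Λ e (D - e)
    have hr := ppSmoothRatio_mem_Ioo hlo e (D - e)
    have hdk : |κ' (1 - ppSmoothRatio lo e (D - e)) - κ' (ppSmoothRatio lo e (D - e))| ≤ 2 * κ₁ := by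
      have hk1 := hκ'b _ ⟨hr.1.le, hr.2.le⟩
      have hk2 := hκ'b (1 - ppSmoothRatio lo e (D - e)) ⟨by linarith [hr.2], by linarith [hr.1]⟩
      calc _ ≤ |κ' (1 - ppSmoothRatio lo e (D - e))| + |κ' (ppSmoothRatio lo e (D - e))| := abs_sub _ _
        _ ≤ 2 * κ₁ := by linarith
    -- `|ρ| ≤ q lo²/e²`
    have hρ : |lo ^ 2 * (e ^ 2 - (D - e) ^ 2) / (ppSmoothScale lo e * ppSmoothScale lo (D - e) * (ppSmoothScale lo e + ppSmoothScale lo (D - e)) ^ 2)| ≤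
        q * (lo ^ 2 / e ^ 2) := by
      have hSe2 := ppSmoothScale_sq lo e
      have hSu2 := ppSmoothScale_sq lo (D - e)
      have hnum : |e ^ 2 - (D - e) ^ 2| ≤ (ppSmoothScale lo e + ppSmoothScale lo (D - e)) ^ 2 := by
        rw [abs_le]; constructor <;> nlinarith [sq_nonneg lo, mul_pos h1 h2]
      have hprod : e ^ 2 ≤ q * (ppSmoothScale lo e * ppSmoothScale lo (D - e)) := by
        -- `e² ≤ m̃ₑ² = m̃ₑ·m̃ₑ ≤ m̃ₑ·(q m̃ᵤ)`
        have : e ^ 2 ≤ ppSmoothScale lo e ^ 2 := by rw [hSe2]; nlinarith [sq_nonneg lo]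
        nlinarith [hz.2, this]
      have hden : 0 < ppSmoothScale lo e * ppSmoothScale lo (D - e) * (ppSmoothScale lo e + ppSmoothScale lo (D - e)) ^ 2 := by positivity
      rw [abs_div, abs_mul, abs_of_nonneg (sq_nonneg lo), abs_of_pos hden, div_le_iff₀ hden]
      calc lo ^ 2 * |e ^ 2 - (D - e) ^ 2| ≤ lo ^ 2 * (ppSmoothScale lo e + ppSmoothScale lo (D - e)) ^ 2 := by gcongr
        _ = lo ^ 2 / e ^ 2 * e ^ 2 * (ppSmoothScale lo e + ppSmoothScale lo (D - e)) ^ 2 := by field_simp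
        _ ≤ lo ^ 2 / e ^ 2 * (q * (ppSmoothScale lo e * ppSmoothScale lo (D - e))) * (ppSmoothScale lo e + ppSmoothScale lo (D - e)) ^ 2 := by gcongr
        _ = q * (lo ^ 2 / e ^ 2) * (ppSmoothScale lo e * ppSmoothScale lo (D - e) * (ppSmoothScale lo e + ppSmoothScale lo (D - e)) ^ 2) := by ring
    rw [abs_mul, abs_mul]
    calc |ppTrueNumerator β Λ e (D - e)| * |κ' (1 - ppSmoothRatio lo e (D - e)) - κ' (ppSmoothRatio lo e (D - e))| *
          |lo ^ 2 * (e ^ 2 - (D - e) ^ 2) / (ppSmoothScale lo e * ppSmoothScale lo (D - e) * (ppSmoothScale lo e + ppSmoothScale lo (D - e)) ^ 2)|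
        ≤ 1 * (2 * κ₁) * (q * (lo ^ 2 / e ^ 2)) := by gcongr
      _ = _ := by ring
  · obtain ⟨-, h1', h2'⟩ := midFactor_eq_zero_of_not_comparable ht₀ ht25 hκs hκ's hκ1 hκ'1 hlo hz
    rw [h1', h2', sub_zero, mul_zero, zero_mul, abs_zero]; positivity

include hβ hκb hlo in
/-- The boundary function: `|Φ(x)| = |x·N(x,D−x)·μ(x)| ≤ |x|·(1+2κ₀)`. [folklore] -/
theorem abs_midPhi_le (D x : ℝ) :
    |x * ppTrueNumerator β Λ x (D - x) * (1 - κ (ppSmoothRatio lo x (D - x)) - κ (1 - ppSmoothRatio lo x (D - x)))| ≤ |x| * (1 + 2 * κ₀) := by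
  have hκ₀ : 0 ≤ κ₀ := (abs_nonneg _).trans (hκb 0 (left_mem_Icc.2 zero_le_one))
  have hr := ppSmoothRatio_mem_Ioo hlo x (D - x)
  have hμ : |1 - κ (ppSmoothRatio lo x (D - x)) - κ (1 - ppSmoothRatio lo x (D - x))| ≤ 1 + 2 * κ₀ := by
    have hk1 := hκb _ ⟨hr.1.le, hr.2.le⟩
    have hk2 := hκb (1 - ppSmoothRatio lo x (D - x)) ⟨by linarith [hr.2], by linarith [hr.1]⟩
    have h3 := abs_sub (1 : ℝ) (κ (ppSmoothRatio lo x (D - x))); rw [abs_one] at h3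
    calc _ ≤ |1 - κ (ppSmoothRatio lo x (D - x))| + |κ (1 - ppSmoothRatio lo x (D - x))| := abs_sub _ _
      _ ≤ 1 + 2 * κ₀ := by linarith
  rw [abs_mul, abs_mul]
  calc |x| * |ppTrueNumerator β Λ x (D - x)| * _ ≤ |x| * 1 * (1 + 2 * κ₀) := by
        gcongr; exact abs_ppTrueNumerator_le_one hβ Λ x (D - x)
    _ = |x| * (1 + 2 * κ₀) := by ring

include ht₀ ht25 hκs hκ's hκ1 hκ'1 hlo in
/-- The lower boundary term vanishes when the partner there is `2q′×` coarser: `lo ≤ a`, `2q′a ≤ |D−a|` ⟹ `Φ(a) = 0`. [folklore] -/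
theorem midPhi_eq_zero_of_ge {D a : ℝ} (ha : lo ≤ a) (hfar : 2 * ((2 - t₁) / t₁) * a ≤ |D - a|) :
    a * ppTrueNumerator β Λ a (D - a) * (1 - κ (ppSmoothRatio lo a (D - a)) - κ (1 - ppSmoothRatio lo a (D - a))) = 0 := by
  have hz := not_comparable_of_ge ht₀ ht25 hlo ha hfar
  obtain ⟨h0, -, -⟩ := midFactor_eq_zero_of_not_comparable ht₀ ht25 hκs hκ's hκ1 hκ'1 hlo hz
  rw [h0, mul_zero]

set_option maxHeartbeats 400000 in
include hβ hΛ hκb hlo in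
/-- **The upper boundary term is thermally small**: `Λ < D`, `2D ≤ b` ⟹ `|Φ(b)| ≤ 2(1+2κ₀)/β` (`0 ≤ N(b,D−b) ≤ e^{−β(b−D)}`, `b·e^{−βb/2} ≤ …`).
[cite: BenfattoGiulianiMastropietro2006, §2.1 (2.2)-(2.5)] -/
theorem abs_midPhi_thermal_le {D b : ℝ} (hD : Λ < D) (hb : 2 * D ≤ b) :
    |b * ppTrueNumerator β Λ b (D - b) * (1 - κ (ppSmoothRatio lo b (D - b)) - κ (1 - ppSmoothRatio lo b (D - b)))| ≤ 2 * (1 + 2 * κ₀) / β := by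
  have hκ₀ : 0 ≤ κ₀ := (abs_nonneg _).trans (hκb 0 (left_mem_Icc.2 zero_le_one))
  have hD0 : 0 < D := hΛ.trans hD
  have hb0 : 0 < b := by linarith
  have hbf : Λ < |b| := by rw [abs_of_pos hb0]; linarith
  have huf : Λ < |D - b| := by rw [abs_of_neg (by linarith)]; linarith
  have hN := ppTrueNumerator_far_far hβ hΛ hbf huf
  -- `0 ≤ N ≤ e^{−β(b−D)}`
  have hmono : Real.tanh (β * (b - D) / 2) ≤ Real.tanh (β * b / 2) := by
    have hx : Real.tanh (β * (b - D) / 2) ∈ Set.Ioo (-1 : ℝ) 1 := ⟨Real.neg_one_lt_tanh _, Real.tanh_lt_one _⟩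
    have hy : Real.tanh (β * b / 2) ∈ Set.Ioo (-1 : ℝ) 1 := ⟨Real.neg_one_lt_tanh _, Real.tanh_lt_one _⟩
    exact (Real.artanh_le_artanh_iff hx hy).1 (by rw [Real.artanh_tanh, Real.artanh_tanh]; nlinarith)
  have hgap : 1 - Real.tanh (β * (b - D) / 2) ≤ 2 * Real.exp (-(β * (b - D))) := by
    have h := one_sub_tanh_le_two_exp_neg (β * (b - D) / 2)
    rwa [show 2 * (β * (b - D) / 2) = β * (b - D) by ring] at h
  have hlt1 : Real.tanh (β * b / 2) < 1 := Real.tanh_lt_one _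
  have hNeq : ppTrueNumerator β Λ b (D - b) = 1 / 2 * (Real.tanh (β * b / 2) - Real.tanh (β * (b - D) / 2)) := by
    rw [hN, show β * (D - b) / 2 = -(β * (b - D) / 2) by ring, Real.tanh_neg]; ring
  have hN0 : 0 ≤ ppTrueNumerator β Λ b (D - b) := by rw [hNeq]; nlinarith
  have hN1 : ppTrueNumerator β Λ b (D - b) ≤ Real.exp (-(β * (b - D))) := by rw [hNeq]; nlinarith
  -- `b·e^{−β(b−D)} ≤ b·e^{−βb/2} ≤ 2/β`
  have hexp : Real.exp (-(β * (b - D))) ≤ Real.exp (-(β * (b / 2))) := Real.exp_le_exp.2 (by nlinarith)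
  have hbe : b * Real.exp (-(β * (b - D))) ≤ 2 / β := by
    have h := mul_exp_neg_le_inv hβ (b / 2)
    calc b * Real.exp (-(β * (b - D))) ≤ b * Real.exp (-(β * (b / 2))) := by gcongr
      _ = 2 * (b / 2 * Real.exp (-(β * (b / 2)))) := by ring
      _ ≤ 2 * (1 / β) := by gcongr
      _ = 2 / β := by ring
  have hr := ppSmoothRatio_mem_Ioo hlo b (D - b)
  have hμ : |1 - κ (ppSmoothRatio lo b (D - b)) - κ (1 - ppSmoothRatio lo b (D - b))| ≤ 1 + 2 * κ₀ := by
    have hk1 := hκb _ ⟨hr.1.le, hr.2.le⟩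
    have hk2 := hκb (1 - ppSmoothRatio lo b (D - b)) ⟨by linarith [hr.2], by linarith [hr.1]⟩
    have h3 := abs_sub (1 : ℝ) (κ (ppSmoothRatio lo b (D - b))); rw [abs_one] at h3
    calc _ ≤ |1 - κ (ppSmoothRatio lo b (D - b))| + |κ (1 - ppSmoothRatio lo b (D - b))| := abs_sub _ _
      _ ≤ 1 + 2 * κ₀ := by linarith
  rw [abs_mul, abs_mul, abs_of_pos hb0, abs_of_nonneg hN0]
  calc b * ppTrueNumerator β Λ b (D - b) * |1 - κ (ppSmoothRatio lo b (D - b)) - κ (1 - ppSmoothRatio lo b (D - b))|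
      ≤ b * Real.exp (-(β * (b - D))) * (1 + 2 * κ₀) := by gcongr
    _ ≤ 2 / β * (1 + 2 * κ₀) := by gcongr
    _ = 2 * (1 + 2 * κ₀) / β := by ring

end Sizes

/-! ## §2 The flatness bounds -/

section Flatness

variable {β Λ : ℝ} (hβ : 0 < β) (hΛ : 0 < Λ) {B₁ B₂ : ℝ} (hB₁ : ∀ x, |deriv salmhoferCutoff x| ≤ B₁) (hB₂ : ∀ x, |deriv (deriv salmhoferCutoff) x| ≤ B₂)
  {κ κ' : ℝ → ℝ} (hκ : ∀ t, HasDerivAt κ (κ' t) t) (hκ'c : Continuous κ')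
  {κ₀ κ₁ : ℝ} (hκb : ∀ t ∈ Icc 0 1, |κ t| ≤ κ₀) (hκ'b : ∀ t ∈ Icc 0 1, |κ' t| ≤ κ₁)
  {t₁ : ℝ} (ht₀ : 0 < t₁) (ht25 : t₁ ≤ 2 / 5)
  (hκs : ∀ t, t₁ ≤ t → κ t = 0) (hκ's : ∀ t, t₁ ≤ t → κ' t = 0) (hκ1 : ∀ t, t ≤ t₁ / 2 → κ t = 1) (hκ'1 : ∀ t, t ≤ t₁ / 2 → κ' t = 0)
  {lo : ℝ} (hlo : 0 < lo) (hloΛ : lo ≤ Λ)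

set_option maxHeartbeats 400000 in
include hβ hΛ hB₁ hκ hκ'c hκb hκ'b ht₀ ht25 hκs hκ's hκ1 hκ'1 hlo hloΛ in
/-- **CONSTANT-WEIGHT FLATNESS, LARGE ANTI-DIAGONAL LEVELS, core form** (`D ≥ 2q′(Λ+lo)`, `lo ≤ a ≤ b`, `2D ≤ b`):
`D²·|∫_a^b ∂ᵤM(e,D−e) de| ≤ 6(1+2κ₀)/β + 2κ₁q′·lo + |Φ(a)|`, `Φ(a) = a·N(a,D−a)·μ(a)` the lower boundary term. [cite: BenfattoGiulianiMastropietro2006, §2.4 (2.36)] -/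
theorem abs_midFlatness_line_le_of_ge_core {D a b : ℝ} (hD : 2 * ((2 - t₁) / t₁) * (Λ + lo) ≤ D) (ha : lo ≤ a) (hab : a ≤ b) (hb : 2 * D ≤ b) :
    D ^ 2 * |∫ e in a..b, deriv (fun v : ℝ => ppMidKernelS β Λ κ lo e v) (D - e)| ≤
      6 * (1 + 2 * κ₀) / β + 2 * κ₁ * ((2 - t₁) / t₁) * lo +
        |a * ppTrueNumerator β Λ a (D - a) * (1 - κ (ppSmoothRatio lo a (D - a)) - κ (1 - ppSmoothRatio lo a (D - a)))| := by
  have hκ₀ : 0 ≤ κ₀ := (abs_nonneg _).trans (hκb 0 (left_mem_Icc.2 zero_le_one))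
  have hκ₁ : 0 ≤ κ₁ := (abs_nonneg _).trans (hκ'b 0 (left_mem_Icc.2 zero_le_one))
  set q : ℝ := (2 - t₁) / t₁ with hq
  have hq4 : 4 ≤ q := midRatio_ge_four ht₀ ht25
  have hD0 : 0 < D := by nlinarith
  have hDΛ : Λ < D := by nlinarith
  have ha0 : 0 < a := hlo.trans_le ha
  -- the identity
  have hid := midFlatness_integral_identity hβ hΛ hB₁ hκ hκ'c hlo hD0 a b
  rw [show D ^ 2 * |∫ e in a..b, deriv (fun v : ℝ => ppMidKernelS β Λ κ lo e v) (D - e)| =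
      |D ^ 2 * ∫ e in a..b, deriv (fun v : ℝ => ppMidKernelS β Λ κ lo e v) (D - e)| by rw [abs_mul, abs_of_pos (pow_pos hD0 2)], hid]
  -- the defect integral
  set g : ℝ → ℝ := fun e => (1 + 2 * κ₀) * (β * e * Real.exp (-(β * e)) + β * |D - e| * Real.exp (-(β * |D - e|))) + 2 * κ₁ * q * (lo ^ 2 / e ^ 2) with hg
  have hgc : ContinuousOn g (uIcc a b) := by
    rw [uIcc_of_le hab]
    refine (Continuous.continuousOn (by fun_prop)).add (continuousOn_const.mul (continuousOn_const.div (continuousOn_pow 2) fun e he => ?_))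
    exact pow_ne_zero 2 (ha0.trans_le he.1).ne'
  have hbound : ∀ᵐ e ∂volume, e ∈ Ioc a b → ‖(e * ppTrueNumeratorDu β Λ (D - e) e + (D - e) * ppTrueNumeratorDu β Λ e (D - e)) *
        (1 - κ (ppSmoothRatio lo e (D - e)) - κ (1 - ppSmoothRatio lo e (D - e))) +
      ppTrueNumerator β Λ e (D - e) * (κ' (1 - ppSmoothRatio lo e (D - e)) - κ' (ppSmoothRatio lo e (D - e))) *
        (lo ^ 2 * (e ^ 2 - (D - e) ^ 2) / (ppSmoothScale lo e * ppSmoothScale lo (D - e) * (ppSmoothScale lo e + ppSmoothScale lo (D - e)) ^ 2))‖ ≤ g e := by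
    refine Filter.Eventually.of_forall fun e he => ?_
    have he0 : 0 < e := ha0.trans he.1
    rw [Real.norm_eq_abs]
    exact (abs_add_le _ _).trans (add_le_add (abs_eulerDefect_mu_le hβ hΛ hB₁ hκb ht₀ ht25 hκs hκ's hκ1 hκ'1 hlo hloΛ hD he0)
      (abs_n_mprime_rho_le hβ hκ'b ht₀ ht25 hκs hκ's hκ1 hκ'1 hlo D he0))
  have hI := intervalIntegral.norm_integral_le_of_norm_le hab hbound (hgc.intervalIntegrable)
  rw [Real.norm_eq_abs] at hI
  -- `∫ g ≤ (1+2κ₀)(2/β + 2/β) + 2κ₁q·lo`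
  have hg1 : ∫ e in a..b, β * e * Real.exp (-(β * e)) ≤ 2 / β := by
    refine (integral_mul_exp_neg_mul_le hβ ha0.le hab).trans ?_
    have h1 := mul_exp_neg_le_inv hβ a
    have h2 : Real.exp (-(β * a)) ≤ 1 := by rw [Real.exp_le_one_iff]; nlinarith
    calc (a + 1 / β) * Real.exp (-(β * a)) = a * Real.exp (-(β * a)) + 1 / β * Real.exp (-(β * a)) := by ring
      _ ≤ 1 / β + 1 / β * 1 := add_le_add h1 (mul_le_mul_of_nonneg_left h2 (by positivity))
      _ = 2 / β := by ring
  have hg2 : ∫ e in a..b, β * |D - e| * Real.exp (-(β * |D - e|)) ≤ 2 / β := by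
    have h := intervalIntegral.integral_comp_sub_left (fun x : ℝ => β * |x| * Real.exp (-(β * |x|))) D (a := a) (b := b)
    rw [h]
    exact integral_beta_abs_exp_le hβ (by linarith)
  have hg3 : ∫ e in a..b, lo ^ 2 / e ^ 2 ≤ lo := by
    refine (intervalIntegral_const_div_sq_le ha0 hab (sq_nonneg lo)).trans ?_
    rw [div_le_iff₀ ha0]; nlinarith
  have hgi1 : IntervalIntegrable (fun e : ℝ => β * e * Real.exp (-(β * e))) volume a b := (by fun_prop : Continuous fun e : ℝ => _).intervalIntegrable a b
  have hgi2 : IntervalIntegrable (fun e : ℝ => β * |D - e| * Real.exp (-(β * |D - e|))) volume a b :=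
    (by fun_prop : Continuous fun e : ℝ => β * |D - e| * Real.exp (-(β * |D - e|))).intervalIntegrable a b
  have hgi3 : IntervalIntegrable (fun e : ℝ => lo ^ 2 / e ^ 2) volume a b := by
    refine (continuousOn_const.div (continuousOn_pow 2) fun e he => ?_).intervalIntegrable
    rw [uIcc_of_le hab] at he
    exact pow_ne_zero 2 (ha0.trans_le he.1).ne'
  have hgint : ∫ e in a..b, g e = (1 + 2 * κ₀) * ((∫ e in a..b, β * e * Real.exp (-(β * e))) + ∫ e in a..b, β * |D - e| * Real.exp (-(β * |D - e|))) +
      2 * κ₁ * q * ∫ e in a..b, lo ^ 2 / e ^ 2 := by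
    simp only [hg]
    rw [intervalIntegral.integral_add ((hgi1.add hgi2).const_mul _) (hgi3.const_mul _), intervalIntegral.integral_const_mul,
      intervalIntegral.integral_const_mul, intervalIntegral.integral_add hgi1 hgi2]
  have hgle : ∫ e in a..b, g e ≤ (1 + 2 * κ₀) * (2 / β + 2 / β) + 2 * κ₁ * q * lo := by
    rw [hgint]
    exact add_le_add (mul_le_mul_of_nonneg_left (add_le_add hg1 hg2) (by positivity)) (mul_le_mul_of_nonneg_left hg3 (by positivity))
  -- boundary terms
  have hΦb := abs_midPhi_thermal_le hβ hΛ hκb hlo hDΛ hb (κ := κ)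
  refine (abs_sub _ _).trans ((add_le_add (hI.trans hgle) ((abs_sub _ _).trans (add_le_add hΦb le_rfl))).trans (le_of_eq ?_))
  ring

include hβ hΛ hB₁ hκ hκ'c hκb hκ'b ht₀ ht25 hκs hκ's hκ1 hκ'1 hlo hloΛ in
/-- **… with the crude lower boundary term `|Φ(a)| ≤ a(1+2κ₀)`** (fine for `a = lo`). [cite: BenfattoGiulianiMastropietro2006, §2.4 (2.36)] -/
theorem abs_midFlatness_line_le_of_ge {D a b : ℝ} (hD : 2 * ((2 - t₁) / t₁) * (Λ + lo) ≤ D) (ha : lo ≤ a) (hab : a ≤ b) (hb : 2 * D ≤ b) :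
    D ^ 2 * |∫ e in a..b, deriv (fun v : ℝ => ppMidKernelS β Λ κ lo e v) (D - e)| ≤
      6 * (1 + 2 * κ₀) / β + 2 * κ₁ * ((2 - t₁) / t₁) * lo + a * (1 + 2 * κ₀) := by
  have h := abs_midFlatness_line_le_of_ge_core hβ hΛ hB₁ hκ hκ'c hκb hκ'b ht₀ ht25 hκs hκ's hκ1 hκ'1 hlo hloΛ hD ha hab hb
  have hΦa := abs_midPhi_le hβ hκb hlo D a (κ := κ) (Λ := Λ)
  rw [abs_of_pos (hlo.trans_le ha)] at hΦa
  linarith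

include hβ hΛ hB₁ hκ hκ'c hκb hκ'b ht₀ ht25 hκs hκ's hκ1 hκ'1 hlo hloΛ in
/-- **… with the lower end OFF the zone** (`2q′a ≤ |D − a|` ⟹ `Φ(a) = 0`): `D²·|∫_a^b| ≤ 6(1+2κ₀)/β + 2κ₁q′·lo` — the `lo/D²`-class band/line flatness
(e.g. the 5b-M band `a = max lo (D/C′)`, `C′ ≥ 2q′+1`). [cite: BenfattoGiulianiMastropietro2006, §2.4 (2.36)] -/
theorem abs_midFlatness_line_le_of_ge_offZone {D a b : ℝ} (hD : 2 * ((2 - t₁) / t₁) * (Λ + lo) ≤ D) (ha : lo ≤ a) (hab : a ≤ b) (hb : 2 * D ≤ b)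
    (hΦa : 2 * ((2 - t₁) / t₁) * a ≤ |D - a|) :
    D ^ 2 * |∫ e in a..b, deriv (fun v : ℝ => ppMidKernelS β Λ κ lo e v) (D - e)| ≤ 6 * (1 + 2 * κ₀) / β + 2 * κ₁ * ((2 - t₁) / t₁) * lo := by
  have h := abs_midFlatness_line_le_of_ge_core hβ hΛ hB₁ hκ hκ'c hκb hκ'b ht₀ ht25 hκs hκ's hκ1 hκ'1 hlo hloΛ hD ha hab hb
  rw [midPhi_eq_zero_of_ge ht₀ ht25 hκs hκ's hκ1 hκ'1 hlo ha hΦa (β := β) (Λ := Λ) (κ := κ), abs_zero, add_zero] at h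
  exact h

set_option maxHeartbeats 400000 in
include hβ hΛ hB₁ hB₂ hκ hκ'c hκb hκ'b ht₀ ht25 hκs hκ's hκ1 hκ'1 hlo hloΛ in
/-- **CONSTANT-WEIGHT ANTI-DIAGONAL FLATNESS OF `M` IS `lo/D²`-CLASS** (every `D > 0`; `lo ≤ b`, `2D ≤ b`):
`|∫_{lo}^{b} ∂ᵤM(e, D−e) de| ≤ (4q′²((Λ+lo)/lo)²·C₁ + (1+2κ₀)(1 + 6/(β·lo)) + 2κ₁q′)·lo/D²`, `C₁ = (1+2κ₀)C_P1 + 2κ₁(12B₁+9)`, `q′ = (2−t₁)/t₁`.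
[cite: BenfattoGiulianiMastropietro2006, §2.4 (2.36)] -/
theorem abs_midFlatness_line_le {D b : ℝ} (hD : 0 < D) (hlob : lo ≤ b) (hb : 2 * D ≤ b) :
    |∫ e in lo..b, deriv (fun v : ℝ => ppMidKernelS β Λ κ lo e v) (D - e)| ≤
      (4 * ((2 - t₁) / t₁) ^ 2 * ((Λ + lo) / lo) ^ 2 * ((1 + 2 * κ₀) * (128 * B₂ + 216 * B₁ + 294 + (48 * B₁ + 28) * ((2 - t₁) / t₁)) + 2 * κ₁ * (12 * B₁ + 9)) +
          (1 + 2 * κ₀) * (1 + 6 / (β * lo)) + 2 * κ₁ * ((2 - t₁) / t₁)) * (lo / D ^ 2) := by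
  have hB0 := salmhoferB₁_nonneg hB₁
  have hB20 : 0 ≤ B₂ := (abs_nonneg _).trans (hB₂ 0)
  have hκ₀ : 0 ≤ κ₀ := (abs_nonneg _).trans (hκb 0 (left_mem_Icc.2 zero_le_one))
  have hκ₁ : 0 ≤ κ₁ := (abs_nonneg _).trans (hκ'b 0 (left_mem_Icc.2 zero_le_one))
  set q : ℝ := (2 - t₁) / t₁ with hq
  have hq4 : 4 ≤ q := midRatio_ge_four ht₀ ht25
  set C₁ : ℝ := (1 + 2 * κ₀) * (128 * B₂ + 216 * B₁ + 294 + (48 * B₁ + 28) * q) + 2 * κ₁ * (12 * B₁ + 9) with hC₁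
  have hC₁0 : 0 ≤ C₁ := by positivity
  have hT1 : 0 ≤ 4 * q ^ 2 * ((Λ + lo) / lo) ^ 2 * C₁ * (lo / D ^ 2) := by positivity
  have hT2 : 0 ≤ ((1 + 2 * κ₀) * (1 + 6 / (β * lo)) + 2 * κ₁ * q) * (lo / D ^ 2) := by positivity
  rw [show (4 * q ^ 2 * ((Λ + lo) / lo) ^ 2 * C₁ + (1 + 2 * κ₀) * (1 + 6 / (β * lo)) + 2 * κ₁ * q) * (lo / D ^ 2) =
    4 * q ^ 2 * ((Λ + lo) / lo) ^ 2 * C₁ * (lo / D ^ 2) + ((1 + 2 * κ₀) * (1 + 6 / (β * lo)) + 2 * κ₁ * q) * (lo / D ^ 2) by ring]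
  rcases le_or_gt (2 * q * (Λ + lo)) D with hbig | hsmall
  · -- large `D`: the identity
    have h := abs_midFlatness_line_le_of_ge hβ hΛ hB₁ hκ hκ'c hκb hκ'b ht₀ ht25 hκs hκ's hκ1 hκ'1 hlo hloΛ hbig le_rfl hlob hb
    have hD2 : 0 < D ^ 2 := pow_pos hD 2
    have h' : |∫ e in lo..b, deriv (fun v : ℝ => ppMidKernelS β Λ κ lo e v) (D - e)| ≤ (6 * (1 + 2 * κ₀) / β + 2 * κ₁ * q * lo + lo * (1 + 2 * κ₀)) / D ^ 2 := by
      rw [le_div_iff₀ hD2, mul_comm]; exact h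
    refine h'.trans ((le_of_eq ?_).trans (le_add_of_nonneg_left hT1))
    field_simp
    ring
  · -- small `D`: the envelope `C₁/max(e,·)² ≤ C₁/e²`
    have hbound : ∀ᵐ e ∂volume, e ∈ Ioc lo b → ‖deriv (fun v : ℝ => ppMidKernelS β Λ κ lo e v) (D - e)‖ ≤ C₁ / e ^ 2 := by
      refine Filter.Eventually.of_forall fun e he => ?_
      have he0 : 0 < e := hlo.trans he.1
      rw [Real.norm_eq_abs]
      refine (abs_deriv_ppMidKernelS_le hβ hΛ hB₁ hB₂ hκ hκb hκ'b ht₀ ht25 hκs hκ's hκ1 hκ'1 hlo hloΛ he0 (D - e)).trans ?_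
      rw [← hC₁, div_eq_mul_inv, ← inv_pow]
      refine mul_le_mul_of_nonneg_left ?_ hC₁0
      rw [inv_pow, inv_pow]
      exact inv_anti₀ (pow_pos he0 2) (pow_le_pow_left₀ he0.le (le_max_left _ _) 2)
    have hgi : IntervalIntegrable (fun e : ℝ => C₁ / e ^ 2) volume lo b := by
      refine (continuousOn_const.div (continuousOn_pow 2) fun e he => ?_).intervalIntegrable
      rw [uIcc_of_le hlob] at he
      exact pow_ne_zero 2 (hlo.trans_le he.1).ne'
    have hI := intervalIntegral.norm_integral_le_of_norm_le hlob hbound hgi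
    rw [Real.norm_eq_abs] at hI
    have hI' := hI.trans (intervalIntegral_const_div_sq_le hlo hlob hC₁0)
    refine hI'.trans (le_trans ?_ (le_add_of_nonneg_right hT2))
    -- `C₁/lo ≤ 4q²((Λ+lo)/lo)²C₁·lo/D²` because `D < 2q(Λ+lo)`
    rw [show 4 * q ^ 2 * ((Λ + lo) / lo) ^ 2 * C₁ * (lo / D ^ 2) = C₁ / lo * ((2 * q * (Λ + lo)) ^ 2 / D ^ 2) by field_simp; ring]
    have h1 : 1 ≤ (2 * q * (Λ + lo)) ^ 2 / D ^ 2 := by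
      rw [le_div_iff₀ (pow_pos hD 2), one_mul]; exact pow_le_pow_left₀ hD.le hsmall.le 2
    have h0 : 0 ≤ C₁ / lo := by positivity
    nlinarith

end Flatness

end Summit.HubbardSuperconductivity.HubbardSuperconductivity.Theorems.C4a

end
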